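import Mathlib
import Summits.PneNP.PneNP.Theorems.OverlapGapAlgebraSolvableImpliesStableSectionMeanSquareTransfer
import Summits.PneNP.PneNP.Theorems.OverlapGapAlgebraSolvableImpliesStableSectionRepairMean

/-!
# PneNP / OverlapGapAlgebra — crux `SolvableImpliesStableSection` (stmt-PneNP-2463):
# the mean-square engine FROM A MEAN BOUND (1/2) — validity level instead of exact success

Support for crux `stmt-PneNP-2463` (`Summit.PneNP.PneNP.Theses.OverlapGapAlgebra.SolvableImpliesStableSection`).
The landed mean-square transfer `sissMS_concl_of_meanSquareStableSolver` turns an ℓ²-stable map that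
SOLVES an `ε`-fraction of `F_k(n, m)` into the path event of the crux.  For f-free blocks (sections that
are valid but not exact — bounded-round peeling / repair rules) the natural input is weaker: a bound on
the MEAN number of violated clauses.  This file is that variant of the engine at one large `n`
(Chebyshev from the mean is `ra_card_mul_sq_le` of the repair block, line `Sketch`):

* `sissMV_km_card_invalid_le` — validity half: mean-square sensitivity `≤ s₂` plus mean violation
  `∑_Φ V_g(Φ) ≤ μ m · #Inst` give `(k m)·#{V_g > ν m} ≤ 4k·k(2 + L² s₂)/(ν - μ)² · #Inst`;
* `sissMV_pathBound_of_mean` — the engine at ONE large `n` (explicit largeness conditions): jump mass by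
  Markov on `d_H²`, the walk engine `engine_count` with the growing loss of `sissMS_numerics`
  (`ε = 1`, `ν ↦ ν - μ`).
The filter forms and the local-rule interface are in `…MeanSquareFromMeanFilter.lean`.
No new definitions; axioms `propext`, `Classical.choice`, `Quot.sound`.
-/

set_option linter.dupNamespace false -- `Summit.PneNP.PneNP.…`: summit = sub-problem (D-0017)

namespace Summit.PneNP.PneNP.Theorems

open Finset Filter Asymptotics
open scoped Classical

section FromMean

variable {m k n : ℕ}

/-- **Validity half of the engine from a mean bound (fixed `k, m, n`).** Let `g` have mean-square
single-literal-resample sensitivity `∑_{(a,b)} ∑_{(Φ,ℓ)} d_H(g Φ, g Φ[(a,b) ↦ ℓ])² ≤ s₂·(m k)·#Inst·2n`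
(`0 ≤ s₂`), let `m²·#{Φ : L < D Φ} ≤ #Inst`, and let the MEAN violated-clause count satisfy
`∑_Φ V_g(Φ) ≤ μ m · #Inst` with `μ < ν`. Then `G = {Φ : V_g Φ ≤ ν m}` has
`(k m)·#Gᶜ ≤ 4k·k(2 + L² s₂)/(ν - μ)² · #Inst`. -/
theorem sissMV_km_card_invalid_le (hn : 1 ≤ n) (hm : 1 ≤ m)
    (g : (Fin m → Fin k → Fin n × Bool) → (Fin n → Bool)) (s₂ μ ν : ℝ) (hs : 0 ≤ s₂)
    (hμν : μ < ν) (L : ℕ)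
    (hS : (∑ a : Fin m, ∑ b : Fin k, ∑ p : (Fin m → Fin k → Fin n × Bool) × (Fin n × Bool),
        (hammingDist (g p.1) (g (Function.update p.1 a (Function.update (p.1 a) b p.2))) : ℝ) ^ 2)
      ≤ s₂ * (((m * k : ℕ) : ℝ) * (Fintype.card (Fin m → Fin k → Fin n × Bool) * (2 * n))))
    (hBad : (m : ℝ) ^ 2 * (((univ : Finset (Fin m → Fin k → Fin n × Bool)).filter fun Φ =>
        L < (univ : Finset (Fin n)).sup fun v =>
          ((univ : Finset (Fin m)).filter fun i => ∃ j, (Φ i j).1 = v).card).card : ℝ)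
      ≤ Fintype.card (Fin m → Fin k → Fin n × Bool))
    (hmean : (∑ Φ : Fin m → Fin k → Fin n × Bool,
        (((univ : Finset (Fin m)).filter fun i => ∀ j, g Φ (Φ i j).1 ≠ (Φ i j).2).card : ℝ))
      ≤ μ * m * Fintype.card (Fin m → Fin k → Fin n × Bool))
    (G : Finset (Fin m → Fin k → Fin n × Bool))
    (hGdef : G = (univ : Finset (Fin m → Fin k → Fin n × Bool)).filter fun Φ =>
      ((((univ : Finset (Fin m)).filter fun i => ∀ j, g Φ (Φ i j).1 ≠ (Φ i j).2).card : ℕ) : ℝ)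
        ≤ ν * m) :
    ((k * m : ℕ) : ℝ) * (Gᶜ.card : ℝ)
      ≤ 4 * k * (k * (2 + (L : ℝ) ^ 2 * s₂)) / (ν - μ) ^ 2
          * Fintype.card (Fin m → Fin k → Fin n × Bool) := by
  haveI : Nonempty (Fin n × Bool) := ⟨(⟨0, hn⟩, true)⟩
  have hmR : (1 : ℝ) ≤ m := by exact_mod_cast hm
  have hmpos' : (0 : ℝ) < m := by linarith only [hmR]
  have hnR : (1 : ℝ) ≤ n := by exact_mod_cast hn
  have hnpos : (0 : ℝ) < n := by linarith only [hnR]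
  have hτ : 0 < ν - μ := sub_pos.2 hμν
  -- the literal Efron–Stein variance bound (before abbreviating)
  have hW2 := sissMS_sum_sq_dev_le (m := m) (k := k) hn g L
  set N : ℝ := (Fintype.card (Fin m → Fin k → Fin n × Bool) : ℝ) with hN
  have hNpos : 0 < N := by rw [hN]; exact_mod_cast Fintype.card_pos
  set S : ℝ := ∑ a : Fin m, ∑ b : Fin k, ∑ p : (Fin m → Fin k → Fin n × Bool) × (Fin n × Bool),
      (hammingDist (g p.1) (g (Function.update p.1 a (Function.update (p.1 a) b p.2))) : ℝ) ^ 2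
    with hSdef
  set Bad : ℝ := (((univ : Finset (Fin m → Fin k → Fin n × Bool)).filter fun Φ =>
      L < (univ : Finset (Fin n)).sup fun v =>
        ((univ : Finset (Fin m)).filter fun i => ∃ j, (Φ i j).1 = v).card).card : ℝ) with hBadDef
  set V : (Fin m → Fin k → Fin n × Bool) → ℝ := fun Φ =>
      ((((univ : Finset (Fin m)).filter fun i => ∀ j, g Φ (Φ i j).1 ≠ (Φ i j).2).card : ℕ) : ℝ)
    with hVdef
  set W : ℝ := ∑ Φ : Fin m → Fin k → Fin n × Bool,
      (V Φ - (∑ Ψ : Fin m → Fin k → Fin n × Bool, V Ψ) / N) ^ 2 with hWdef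
  set B : ℝ := k * (2 + (L : ℝ) ^ 2 * s₂) with hB
  have hk0 : (0 : ℝ) ≤ k := Nat.cast_nonneg _
  have hBnn : 0 ≤ B := by rw [hB]; positivity
  -- `W ≤ m N B`
  have hLS : (L : ℝ) ^ 2 * S ≤ (L : ℝ) ^ 2 * (s₂ * (((m * k : ℕ) : ℝ) * (N * (2 * n)))) :=
    mul_le_mul_of_nonneg_left hS (sq_nonneg _)
  have hB3 : (m : ℝ) ^ 2 * (((m * k : ℕ) : ℝ) * n) * Bad ≤ (((m * k : ℕ) : ℝ) * n) * N := by
    calc (m : ℝ) ^ 2 * (((m * k : ℕ) : ℝ) * n) * Bad = (((m * k : ℕ) : ℝ) * n) * ((m : ℝ) ^ 2 * Bad) := by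
          ring
      _ ≤ (((m * k : ℕ) : ℝ) * n) * N := mul_le_mul_of_nonneg_left hBad (by positivity)
  have h2n : (2 * n : ℝ) * W ≤ (2 * n) * (m * N * B) := by
    have h1 : (2 * n : ℝ) * W ≤ ((m * k : ℕ) : ℝ) * N * (2 * n)
        + (L : ℝ) ^ 2 * (s₂ * (((m * k : ℕ) : ℝ) * (N * (2 * n)))) + (((m * k : ℕ) : ℝ) * n) * N :=
      hW2.trans (add_le_add (add_le_add le_rfl hLS) hB3)
    have hx : 0 ≤ (m : ℝ) * k * n * N := by positivity
    have h2 : ((m * k : ℕ) : ℝ) * N * (2 * n)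
        + (L : ℝ) ^ 2 * (s₂ * (((m * k : ℕ) : ℝ) * (N * (2 * n)))) + (((m * k : ℕ) : ℝ) * n) * N
        ≤ (2 * n) * (m * N * B) := by
      rw [hB]; push_cast; nlinarith [hx]
    exact h1.trans h2
  have hWB : W ≤ m * N * B := le_of_mul_le_mul_left h2n (by positivity)
  -- Chebyshev from the mean at level `μ m`, gap `(ν - μ) m`
  have hmean' : ∑ Φ, V Φ ≤ μ * m * Fintype.card (Fin m → Fin k → Fin n × Bool) := by
    rw [hVdef]; exact hmean
  -- `Gᶜ = {ν m < V_g}`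
  have hset : Gᶜ = (univ : Finset (Fin m → Fin k → Fin n × Bool)).filter fun Φ => ν * m < V Φ := by
    rw [hGdef, Finset.compl_filter]
    exact Finset.filter_congr fun Φ _ => by rw [hVdef, not_le]
  have hGc : ∀ Φ ∈ Gᶜ, μ * m + (ν - μ) * m < V Φ := by
    intro Φ hΦ
    rw [hset] at hΦ
    have := (Finset.mem_filter.1 hΦ).2
    linarith only [this]
  have hcheb := Summit.PneNP.PneNP.Cruxes.SolvableImpliesStableSection.Sketch.ra_card_mul_sq_le V W
    (μ * m) ((ν - μ) * m) (by positivity) hmean'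
    (le_of_eq hWdef.symm) Gᶜ hGc
  -- `#Gᶜ · ((ν-μ) m)² ≤ m N B`, hence `(k m) #Gᶜ ≤ k B / (ν-μ)² · N ≤ 4 k B / (ν-μ)² · N`
  have h1 : (Gᶜ.card : ℝ) * ((ν - μ) * m) ^ 2 ≤ m * N * B := hcheb.trans hWB
  have hτ2 : 0 < (ν - μ) ^ 2 := by positivity
  have hGle : (Gᶜ.card : ℝ) ≤ N * B / ((ν - μ) ^ 2 * m) := by
    rw [le_div_iff₀ (by positivity)]
    nlinarith [h1, hmpos']
  have hkm : ((k * m : ℕ) : ℝ) = k * m := by push_cast; ring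
  rw [hkm]
  calc (k : ℝ) * m * (Gᶜ.card : ℝ) ≤ k * m * (N * B / ((ν - μ) ^ 2 * m)) :=
        mul_le_mul_of_nonneg_left hGle (by positivity)
    _ = k * B / (ν - μ) ^ 2 * N := by field_simp
    _ ≤ 4 * k * B / (ν - μ) ^ 2 * N := by
        have h0 : 0 ≤ k * B / (ν - μ) ^ 2 * N := by positivity
        have : 4 * k * B / (ν - μ) ^ 2 * N = 4 * (k * B / (ν - μ) ^ 2 * N) := by ring
        rw [this]; linarith only [h0]

/-- **The engine from a mean bound, at one large `n`.** Fix `k ≥ 1`, `α, η > 0`, levels `μ < ν`,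
`c > 0`, a sensitivity scale `s' ≥ 0` and the explicit small constant `δ` of `sissMS_numerics` (with
`ε = 1` and `ν ↦ ν - μ`). At any `n ≥ 3` satisfying the six largeness conditions below and
`m = ⌊α n⌋₊`, every map `g` with mean-square single-literal sensitivity `≤ s'` and mean violated-clause
count `≤ μ m` realises the path event of `SolvableImpliesStableSection` at `(η, ν)` on at least
`e^{-cn}·#paths` of the path tuples. -/
theorem sissMV_pathBound_of_mean (k : ℕ) (hk : 1 ≤ k) (α η ν μ c δ s' : ℝ) (hα : 0 < α)
    (hη : 0 < η) (hμν : μ < ν) (hc : 0 < c) (hs'0 : 0 ≤ s')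
    (hδa : δ ≤ 1 * (ν - μ) ^ 2 * α / (144 * k)) (hδη : δ ≤ η ^ 2 / (k * α))
    (hδc : δ ≤ c * (ν - μ) ^ 2 / (576 * k ^ 3)) (hδb : δ ≤ α * (ν - μ) ^ 2 / (288 * k))
    (n m : ℕ) (hn3 : 3 ≤ n) (hC1 : s' * Real.log n ^ 3 ≤ δ * n)
    (hC3 : (16 * k + 1 * (ν - μ) ^ 2) * 2 / (1 * (ν - μ) ^ 2 * α) ≤ (n : ℝ))
    (hC4 : (1 + 64 * k ^ 3 / (ν - μ) ^ 2 + 8 * k) * Real.log n ≤ c * n / 2)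
    (hC5 : 2 * (32 * k ^ 3 / (ν - μ) ^ 2 + 4 * k + 1 + k ^ 2) / (k ^ 2 * α) ≤ (n : ℝ))
    (hC7 : α ^ 2 * Real.exp (α * k * Real.exp 2) ≤ (n : ℝ))
    (hC8 : α * (ν - μ) ^ 2 * Real.exp (α * k * Real.exp 2) ≤ (n : ℝ))
    (hm : m = ⌊α * n⌋₊)
    (g : (Fin m → Fin k → Fin n × Bool) → (Fin n → Bool))
    (hg' : (∑ a : Fin m, ∑ b : Fin k, ∑ p : (Fin m → Fin k → Fin n × Bool) × (Fin n × Bool),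
        (hammingDist (g p.1) (g (Function.update p.1 a (Function.update (p.1 a) b p.2))) : ℝ) ^ 2)
      ≤ s' * (((m * k : ℕ) : ℝ) * (Fintype.card (Fin m → Fin k → Fin n × Bool) * (2 * n))))
    (hmean : (∑ Φ : Fin m → Fin k → Fin n × Bool,
        (((univ : Finset (Fin m)).filter fun i => ∀ j, g Φ (Φ i j).1 ≠ (Φ i j).2).card : ℝ))
      ≤ μ * m * Fintype.card (Fin m → Fin k → Fin n × Bool)) :
    Real.exp (-(c * n)) * Fintype.card (Fin (k + 1) → Fin m → Fin k → Fin n × Bool) ≤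
      ((Finset.univ.filter fun Ψ : Fin (k + 1) → Fin m → Fin k → Fin n × Bool =>
        let P : Fin k → ℕ → Fin m → Fin k → Fin n × Bool :=
          fun r q a b => if (a : ℕ) * k + b < q then Ψ r.succ a b else Ψ r.castSucc a b
        (∀ r : Fin k, ∀ q ≤ m * k, ((Finset.univ.filter fun i : Fin m =>
          ∀ j, g (P r q) (P r q i j).1 ≠ (P r q i j).2).card : ℝ) ≤ ν * m) ∧
        ∀ r : Fin k, ∀ q < m * k,
          (hammingDist (g (P r q)) (g (P r (q + 1))) : ℝ) ≤ η * n).card : ℝ) := by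
  -- adapted from `sissMS_concl_of_meanSquareStableSolver` (…MeanSquareTransfer.lean): the boost from
  -- exact success is replaced by Chebyshev from the mean (`sissMV_km_card_invalid_le`)
  have hkR : (1 : ℝ) ≤ k := by exact_mod_cast hk
  have hk0 : (0 : ℝ) < k := by linarith
  set τ : ℝ := ν - μ with hτdef
  have hτ : 0 < τ := sub_pos.2 hμν
  -- numerics of `n` and `m`
  have hn1 : 1 ≤ n := le_trans (by norm_num) hn3
  have hnR : (1 : ℝ) ≤ n := by exact_mod_cast hn1
  have hn3R : (3 : ℝ) ≤ n := by exact_mod_cast hn3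
  have hnpos : (0 : ℝ) < n := by linarith only [hnR]
  have hxpos : (0 : ℝ) < 2 * n := by linarith only [hnR]
  have hlog2le : Real.log 2 ≤ Real.log (2 * n) := Real.log_le_log two_pos (by linarith only [hnR])
  have hlog1 : 1 ≤ Real.log n := by
    rw [← Real.log_exp 1]
    apply Real.log_le_log (Real.exp_pos 1)
    have : Real.exp 1 ≤ 3 := le_of_lt (lt_trans Real.exp_one_lt_d9 (by norm_num))
    exact this.trans hn3R
  have hm_le : (m : ℝ) ≤ α * n := by rw [hm]; exact Nat.floor_le (by positivity)
  have hm_ge : α * n - 1 ≤ m := by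
    rw [hm]; have := Nat.lt_floor_add_one (α * n); linarith only [this]
  set N : ℝ := (Fintype.card (Fin m → Fin k → Fin n × Bool) : ℝ) with hN
  obtain ⟨hm1, hjumpB, -, ht, hMB⟩ := sissMS_numerics k hk α η τ 1 c δ s' hα hτ one_pos hc hs'0
    hδa hδη hδc hδb n m hn3 hC1 hC3 hC4 hC5 hm_ge hm_le
  -- the degree level `L = ⌈2 log n⌉₊ ≤ 3 log n`
  set L : ℕ := ⌈2 * Real.log n⌉₊ with hL
  have hLge : 2 * Real.log n ≤ L := Nat.le_ceil _
  have hLle : (L : ℝ) ≤ 3 * Real.log n := by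
    have := Nat.ceil_lt_add_one (show 0 ≤ 2 * Real.log n by positivity)
    rw [← hL] at this
    linarith only [this, hlog1]
  have hL9 : (L : ℝ) ^ 2 * s' ≤ 9 * Real.log n ^ 2 * s' := by
    have h1 : (L : ℝ) ^ 2 ≤ (3 * Real.log n) ^ 2 := pow_le_pow_left₀ (Nat.cast_nonneg _) hLle 2
    have h2 : (3 * Real.log n) ^ 2 = 9 * Real.log n ^ 2 := by ring
    rw [← h2]
    exact mul_le_mul_of_nonneg_right h1 hs'0
  -- the exceptional set (maximum clause-degree `> L`) is negligible
  haveI : Nonempty (Fin n × Bool) := ⟨(⟨0, hn1⟩, true)⟩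
  have hNpos : 0 < N := by rw [hN]; exact_mod_cast Fintype.card_pos
  have hBad := (sissT_bad_bounds (m := m) (k := k) (n := n) hn1 α τ hα.le hτ L hm_le hLge hC7 hC8).1
  -- the loss rate `A` and the good set `G`
  obtain ⟨A, hA⟩ : ∃ A : ℝ, A = 4 * k * (k * (2 + 9 * Real.log n ^ 2 * s')) / τ ^ 2 + 1 := ⟨_, rfl⟩
  have hA0 : 0 ≤ A := by rw [hA]; positivity
  have hA1 : 1 ≤ A := by
    rw [hA]
    have : 0 ≤ 4 * k * (k * (2 + 9 * Real.log n ^ 2 * s')) / τ ^ 2 := by positivity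
    linarith only [this]
  have hτ2 : 0 < τ ^ 2 := by positivity
  have hAL : 4 * k * (k * (2 + (L : ℝ) ^ 2 * s')) / τ ^ 2 ≤ A := by
    rw [hA]
    have h1 : 4 * (k : ℝ) * (k * (2 + (L : ℝ) ^ 2 * s')) ≤ 4 * k * (k * (2 + 9 * Real.log n ^ 2 * s')) := by
      apply mul_le_mul_of_nonneg_left _ (by positivity)
      apply mul_le_mul_of_nonneg_left _ hk0.le
      linarith only [hL9]
    have h2 := div_le_div_of_nonneg_right h1 hτ2.le
    linarith only [h2]
  rw [← hA] at ht hMB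
  obtain ⟨G, hGdef⟩ : ∃ G : Finset (Fin m → Fin k → Fin n × Bool),
      G = (univ : Finset (Fin m → Fin k → Fin n × Bool)).filter fun Φ =>
        ((((univ : Finset (Fin m)).filter fun i => ∀ j, g Φ (Φ i j).1 ≠ (Φ i j).2).card : ℕ) : ℝ)
          ≤ ν * m := ⟨_, rfl⟩
  have hval : ∀ Φ ∈ G, ((((univ : Finset (Fin m)).filter fun i =>
      ∀ j, g Φ (Φ i j).1 ≠ (Φ i j).2).card : ℕ) : ℝ) ≤ ν * m := fun Φ hΦ => by
    rw [hGdef] at hΦ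
    exact (Finset.mem_filter.1 hΦ).2
  have hG : ((k * m : ℕ) : ℝ) * (Gᶜ.card : ℝ) ≤ A * Fintype.card (Fin m → Fin k → Fin n × Bool) := by
    have h := sissMV_km_card_invalid_le hn1 hm1 g s' μ ν hs'0 hμν L hg' hBad hmean G hGdef
    exact h.trans (mul_le_mul_of_nonneg_right hAL (Nat.cast_nonneg _))
  -- jump mass by Markov on the squared sensitivity: total `≤ #Inst · 2n ≤ A · #Inst · 2n`
  have hjump : (∑ a : Fin m, ∑ b : Fin k,
      (((Finset.univ : Finset ((Fin m → Fin k → Fin n × Bool) × (Fin n × Bool))).filter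
        fun p => η * n < hammingDist (g p.1)
          (g (Function.update p.1 a (Function.update (p.1 a) b p.2)))).card : ℝ))
      ≤ A * (Fintype.card (Fin m → Fin k → Fin n × Bool) * (2 * n)) := by
    have hηn : 0 < (η * n) ^ 2 := by positivity
    have hsum : (η * n) ^ 2 * (∑ a : Fin m, ∑ b : Fin k,
        (((Finset.univ : Finset ((Fin m → Fin k → Fin n × Bool) × (Fin n × Bool))).filter
          fun p => η * n < hammingDist (g p.1)
            (g (Function.update p.1 a (Function.update (p.1 a) b p.2)))).card : ℝ))
        ≤ ∑ a : Fin m, ∑ b : Fin k, ∑ p : (Fin m → Fin k → Fin n × Bool) × (Fin n × Bool),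
          (hammingDist (g p.1) (g (Function.update p.1 a (Function.update (p.1 a) b p.2))) : ℝ) ^ 2 := by
      rw [Finset.mul_sum]
      refine Finset.sum_le_sum fun a _ => ?_
      rw [Finset.mul_sum]
      exact Finset.sum_le_sum fun b _ => sissMS_card_jump_le g (η * n) (by positivity) a b
    have hchain : (η * n) ^ 2 * (∑ a : Fin m, ∑ b : Fin k,
        (((Finset.univ : Finset ((Fin m → Fin k → Fin n × Bool) × (Fin n × Bool))).filter
          fun p => η * n < hammingDist (g p.1)
            (g (Function.update p.1 a (Function.update (p.1 a) b p.2)))).card : ℝ))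
        ≤ (η * n) ^ 2 * (A * (N * (2 * n))) := by
      calc _ ≤ s' * (((m * k : ℕ) : ℝ) * (N * (2 * n))) := hsum.trans hg'
        _ = (s' * ((m * k : ℕ) : ℝ)) * (N * (2 * n)) := by ring
        _ ≤ (η * n) ^ 2 * (N * (2 * n)) := mul_le_mul_of_nonneg_right hjumpB (by positivity)
        _ = (η * n) ^ 2 * (1 * (N * (2 * n))) := by ring
        _ ≤ (η * n) ^ 2 * (A * (N * (2 * n))) := by
            apply mul_le_mul_of_nonneg_left _ hηn.le
            exact mul_le_mul_of_nonneg_right hA1 (by positivity)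
    have := le_of_mul_le_mul_left hchain hηn
    simpa only [hN, mul_assoc] using this
  -- the engine and the growing-loss asymptotics
  have hE := Summit.PneNP.PneNP.Cruxes.SolvableImpliesStableSection.Sketch.engine_count k m n hn1 η A
    hη.le hA0 g G hG hjump
  have hasym := sissLip_asy_pointwise (M := m * k) (k := k) (Real.exp_log hxpos) hlog2le ht hMB
  -- assembly (as in `concl_of_smoothSection`)
  have hpaths : (Fintype.card (Fin (k + 1) → Fin m → Fin k → Fin n × Bool) : ℝ) =
      (2 * n) ^ (m * k * (k + 1)) := by
    rw [Summit.PneNP.PneNP.Cruxes.SolvableImpliesStableSection.Sketch.eng_card_paths]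
    push_cast
    ring
  have hmono : ((univ : Finset (Fin (k + 1) → Fin m → Fin k → Fin n × Bool)).filter fun Ψ =>
          (∀ r : Fin k, ∀ q ≤ m * k,
            (fun (a : Fin m) (b : Fin k) =>
              if (a : ℕ) * k + b < q then Ψ r.succ a b else Ψ r.castSucc a b) ∈ G) ∧
          ∀ r : Fin k, ∀ q < m * k,
            (hammingDist
              (g fun (a : Fin m) (b : Fin k) =>
                if (a : ℕ) * k + b < q then Ψ r.succ a b else Ψ r.castSucc a b)
              (g fun (a : Fin m) (b : Fin k) =>
                if (a : ℕ) * k + b < q + 1 then Ψ r.succ a b else Ψ r.castSucc a b) : ℝ)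
              ≤ η * n).card ≤
      ((univ : Finset (Fin (k + 1) → Fin m → Fin k → Fin n × Bool)).filter fun Ψ =>
        let P : Fin k → ℕ → Fin m → Fin k → Fin n × Bool :=
          fun r q a b => if (a : ℕ) * k + b < q then Ψ r.succ a b else Ψ r.castSucc a b
        (∀ r : Fin k, ∀ q ≤ m * k, (((Finset.univ : Finset (Fin m)).filter fun i =>
          ∀ j, g (P r q) (P r q i j).1 ≠ (P r q i j).2).card : ℝ) ≤ ν * m) ∧
        ∀ r : Fin k, ∀ q < m * k,
          (hammingDist (g (P r q)) (g (P r (q + 1))) : ℝ) ≤ η * n).card := by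
    refine Finset.card_le_card fun Ψ hΨ => ?_
    simp only [Finset.mem_filter, Finset.mem_univ, true_and] at hΨ ⊢
    obtain ⟨hin, hjmp⟩ := hΨ
    exact ⟨fun r q hq => hval _ (hin r q hq), fun r q hq => hjmp r q hq⟩
  have hmono' := (Nat.cast_le (α := ℝ)).2 hmono
  rw [hpaths]
  linarith only [hasym, hE, hmono']

end FromMean

end Summit.PneNP.PneNP.Theorems
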